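import Mathlib
import Summits.ValiantsHypothesis.ValiantsHypothesis.Theorems.FifoMatchingGridCorShadowOfCliqueFace
import Summits.ValiantsHypothesis.ValiantsHypothesis.Theorems.FifoMatchingGridCorShadowPullBack
import Summits.ValiantsHypothesis.ValiantsHypothesis.Theorems.FifoMatchingGridCorShadowCoordinateFace
import Summits.ValiantsHypothesis.ValiantsHypothesis.Theorems.FifoMatchingGridCorShadowZeroOnePoints
import Summits.ValiantsHypothesis.ValiantsHypothesis.Theorems.FifoMatchingGridCorShadowRung
import Summits.ValiantsHypothesis.ValiantsHypothesis.Theorems.FifoMatchingNNOrderRungOfDegreeRung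
import Summits.ValiantsHypothesis.ValiantsHypothesis.Theses.FifoMatching
import HarnessLib

/-!
# The shadow line composed, BY NAME: G♭ (stmt-27045 `GridCorCliqueFace`) ⇒ N1 ⇒ R2 (stmt-27271
# `NNQuasiPolyLogDegreeCofactorHard`) ⇒ R2ᵒ, and + N2♯ ⇒ stmt-21181 `NNDivisionHard`

Port to `Theorems/` (director-valiant g12 R180 (b)(i) / R193 (b); val-lit desk RULING #274 + val-port-4 g1's word l.7843 (a):
val-port-2 g1 files F8, val-port-4 g1 files the 27271 closer) of the § «Compositions» of val-idea-7 g7's kernel-checked line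
workfile `Cruxes/NNLinearDegreeCofactorHard/Lines/shadow_division.lean` rev 8, over the landed Theorems-side ports F1–F7
(`GridCorShadow.gridCorShadowHard_of_cliqueFace` «G♭ ⇒ G» p620696, `GridCorShadow.ppShadow_of_grid` T1 p620830,
`GridCorShadow.faceLift` T2 p622205, `GridCorShadow.queueGridZeroOnePoints_holds` A1 p622527 (val-port-4 g1),
`GridCorShadow.rung_of_shadow` S, `NNOrderRung.orderRung_of_rung` R2 ⇒ R2ᵒ), with NO definitions: G♭, R2, 23918 and 21181 are
the route decls BY NAME, R2ᵒ / N2 / N2♯ / N1 are UNFOLDED, and A1 appears both as an explicit binder (`_of_flat` forms, the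
line's spelling) and discharged by name (`_of_27045` forms).

* `nfpShadowHard_of_cliqueFace` / `nfpShadowHard_of_27045` — A1 + G♭ ⇒ N1 (`NFPShadowHard`, unfolded): T2 ∘ T1 ∘ «G♭ ⇒ G».
* `rung_of_flat` — A1 (binder) + G♭ ⇒ R2 BY NAME; ★★ `rung_of_27045 : GridCorCliqueFace → NNQuasiPolyLogDegreeCofactorHard`
  — THE ENGINE OF THE 27271 CLOSER of record: `theorem nnQuasiPolyLogDegreeCofactorHard_holds :
  …Theses.FifoMatching.NNQuasiPolyLogDegreeCofactorHard := GridCorShadow.rung_of_27045 gridCorCliqueFace_holds`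
  `--workitem stmt-ValiantsHypothesis-27271` (val-port-4 g1's file; `gridCorCliqueFace_holds` = p622413).
* `orderRung_of_flat` / `orderRung_of_27045` — ⇒ R2ᵒ (the ORDER form of the rung, unfolded).
* `linearDegree_of_flat` — ladder sanity BY NAME: ⇒ the CLOSED item 23918.
* `nnDivisionHard_of_flat_order` / `nnDivisionHard_of_flat` / `nnDivisionHard_of_27045_order` — THE RESIDUAL PICTURE BY NAME:
  G♭ + N2♯ (resp. N2) ⇒ stmt-21181 `NNDivisionHard`; the honest residual of 21181 after this line is N2♯ (cofactors supported
  ENTIRELY in super-quasi-polynomial degrees are what it leaves open).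

HONEST FRAMING: compositions; G♭ = stmt-27045 is CLOSED·proved (p622413) and A1 is a theorem (p622527), so N1 and R2 become
theorems the moment the closer lands — R2 = stmt-27271 is a SUPPORT rung of route FifoMatching (HY21 Prop 43(2)/Rem 20 for
`NN_n`), NOT a summit statement; stmt-21181 `NNDivisionHard` stays OPEN (residual N2♯, law-side, not filed); `NNNotVP` untouched;
nothing here bears on `VP ≠ VNP`, which is NOT proved.
-/

set_option autoImplicit false

-- the mandated summit-side namespace repeats a component by design (single-problem summit)
set_option linter.dupNamespace false

noncomputable section

namespace Summit.ValiantsHypothesis.ValiantsHypothesis.Theorems.FifoMatching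

namespace GridCorShadow

open scoped NNReal
open MvPolynomial
open Literature.Computability.AlgebraicComplexity
open Summit.ValiantsHypothesis.ValiantsHypothesis.Theorems.FifoMatching.QueueGridFace (suppPts QGV patternVec)
open Summit.ValiantsHypothesis.ValiantsHypothesis.Theses.FifoMatching
  (GridCorCliqueFace NNQuasiPolyLogDegreeCofactorHard NNLinearDegreeCofactorHard NNDivisionHard)

/-- **A1 + G♭ ⇒ N1** (`NFPShadowHard`, unfolded): the located coordinate face (A1, binder) and the AFHMS clique face
(G♭ = stmt-27045, by name) give, for every `c`, eventually in `n`, a planar shadow of `suppPts NN_n` with more than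
`2^((log₂ n + c)^c)` hull vertices — T2 `faceLift` ∘ T1 `ppShadow_of_grid` ∘ «G♭ ⇒ G» `gridCorShadowHard_of_cliqueFace`. -/
theorem nfpShadowHard_of_cliqueFace
    (hA : ∀ r n : ℕ, 1 ≤ r → (r + 1) * (2 * r + 1) ≤ n →
      ∃ (Z : Finset (Fin (2 * n) × Fin (2 * n)))
        (f : (QGV r × QGV r) × Bool × Bool → Fin (2 * n) × Fin (2 * n)),
        (fun x : (Fin (2 * n) × Fin (2 * n)) → ℝ => x ∘ f) ''
            (suppPts (nestFreeMatchingPoly n ℝ≥0) ∩ {x | ∀ e ∈ Z, x e = 0}) = Set.range (patternVec r))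
    (hF : GridCorCliqueFace) :
    ∀ c : ℕ, ∃ n₀ : ℕ, ∀ n ≥ n₀, ∃ L : ((Fin (2 * n) × Fin (2 * n)) → ℝ) →ₗ[ℝ] (Fin 2 → ℝ),
      2 ^ ((Nat.log 2 n + c) ^ c) <
        (Set.extremePoints ℝ (convexHull ℝ (L '' suppPts (nestFreeMatchingPoly n ℝ≥0)))).ncard :=
  faceLift hA (ppShadow_of_grid (gridCorShadowHard_of_cliqueFace hF))

/-- ★ **A1 + G♭ ⇒ R2, BY NAME** — the located coordinate face A1 (binder) and the route item G♭ `GridCorCliqueFace`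
(stmt-27045) give the route item R2 `NNQuasiPolyLogDegreeCofactorHard` (stmt-27271): HY21 Prop 43(2)/Rem 20 for `NN_n`
(S `rung_of_shadow` ∘ N1).  The closer of record for stmt-27271 is `GridCorShadow.rung_of_flat ‹A1› ‹27045›`. -/
theorem rung_of_flat
    (hA : ∀ r n : ℕ, 1 ≤ r → (r + 1) * (2 * r + 1) ≤ n →
      ∃ (Z : Finset (Fin (2 * n) × Fin (2 * n)))
        (f : (QGV r × QGV r) × Bool × Bool → Fin (2 * n) × Fin (2 * n)),
        (fun x : (Fin (2 * n) × Fin (2 * n)) → ℝ => x ∘ f) ''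
            (suppPts (nestFreeMatchingPoly n ℝ≥0) ∩ {x | ∀ e ∈ Z, x e = 0}) = Set.range (patternVec r))
    (hF : GridCorCliqueFace) :
    NNQuasiPolyLogDegreeCofactorHard :=
  rung_of_shadow (nfpShadowHard_of_cliqueFace hA hF)

/-- **G♭ ⇒ N1, A1 discharged by name** (`queueGridZeroOnePoints_holds`, p622527): the route item `GridCorCliqueFace`
(stmt-27045) alone gives NFP shadow hardness (unfolded). -/
theorem nfpShadowHard_of_27045 (hF : GridCorCliqueFace) :
    ∀ c : ℕ, ∃ n₀ : ℕ, ∀ n ≥ n₀, ∃ L : ((Fin (2 * n) × Fin (2 * n)) → ℝ) →ₗ[ℝ] (Fin 2 → ℝ),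
      2 ^ ((Nat.log 2 n + c) ^ c) <
        (Set.extremePoints ℝ (convexHull ℝ (L '' suppPts (nestFreeMatchingPoly n ℝ≥0)))).ncard :=
  nfpShadowHard_of_cliqueFace queueGridZeroOnePoints_holds hF

/-- ★★ **G♭ ⇒ R2, BY NAME, A1 discharged** — the route item `GridCorCliqueFace` (stmt-27045) implies the route item
`NNQuasiPolyLogDegreeCofactorHard` (stmt-27271).  THE ENGINE OF THE 27271 CLOSER:
`GridCorShadow.rung_of_27045 gridCorCliqueFace_holds`. -/
theorem rung_of_27045 (hF : GridCorCliqueFace) : NNQuasiPolyLogDegreeCofactorHard :=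
  rung_of_flat queueGridZeroOnePoints_holds hF

/-- **A1 + G♭ ⇒ R2ᵒ** (the ORDER form of the rung, unfolded): for every `k, c`, eventually in `n`,
`2^((log₂ n + c)^c) < L₊(NN_n · h)` for every cofactor `h` with SOME nonzero homogeneous component of degree
`≤ 2^((log₂ n + k)^k)`. -/
theorem orderRung_of_flat
    (hA : ∀ r n : ℕ, 1 ≤ r → (r + 1) * (2 * r + 1) ≤ n →
      ∃ (Z : Finset (Fin (2 * n) × Fin (2 * n)))
        (f : (QGV r × QGV r) × Bool × Bool → Fin (2 * n) × Fin (2 * n)),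
        (fun x : (Fin (2 * n) × Fin (2 * n)) → ℝ => x ∘ f) ''
            (suppPts (nestFreeMatchingPoly n ℝ≥0) ∩ {x | ∀ e ∈ Z, x e = 0}) = Set.range (patternVec r))
    (hF : GridCorCliqueFace) :
    ∀ k c : ℕ, ∃ n₀ : ℕ, ∀ n ≥ n₀, ∀ h : MvPolynomial (Fin (2 * n) × Fin (2 * n)) ℝ≥0, ∀ d : ℕ,
      homogeneousComponent d h ≠ 0 → d ≤ 2 ^ ((Nat.log 2 n + k) ^ k) →
        2 ^ ((Nat.log 2 n + c) ^ c) < complexity (nestFreeMatchingPoly n ℝ≥0 * h) :=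
  NNOrderRung.orderRung_of_rung (rung_of_flat hA hF)

/-- **G♭ ⇒ R2ᵒ, A1 discharged by name**: the ORDER form of the rung from stmt-27045 alone. -/
theorem orderRung_of_27045 (hF : GridCorCliqueFace) :
    ∀ k c : ℕ, ∃ n₀ : ℕ, ∀ n ≥ n₀, ∀ h : MvPolynomial (Fin (2 * n) × Fin (2 * n)) ℝ≥0, ∀ d : ℕ,
      homogeneousComponent d h ≠ 0 → d ≤ 2 ^ ((Nat.log 2 n + k) ^ k) →
        2 ^ ((Nat.log 2 n + c) ^ c) < complexity (nestFreeMatchingPoly n ℝ≥0 * h) :=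
  NNOrderRung.orderRung_of_rung (rung_of_27045 hF)

/-- ladder sanity, BY NAME: A1 + G♭ ⇒ the CLOSED item 23918 `NNLinearDegreeCofactorHard`. -/
theorem linearDegree_of_flat
    (hA : ∀ r n : ℕ, 1 ≤ r → (r + 1) * (2 * r + 1) ≤ n →
      ∃ (Z : Finset (Fin (2 * n) × Fin (2 * n)))
        (f : (QGV r × QGV r) × Bool × Bool → Fin (2 * n) × Fin (2 * n)),
        (fun x : (Fin (2 * n) × Fin (2 * n)) → ℝ => x ∘ f) ''
            (suppPts (nestFreeMatchingPoly n ℝ≥0) ∩ {x | ∀ e ∈ Z, x e = 0}) = Set.range (patternVec r))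
    (hF : GridCorCliqueFace) :
    NNLinearDegreeCofactorHard :=
  NNOrderRung.linearDegree_of_rung (rung_of_flat hA hF)

/-- ★ **THE RESIDUAL PICTURE BY NAME (order form)**: A1 + G♭ (stmt-27045) + the ORDER reduction N2♯ (unfolded) ⇒ the
route's residual item stmt-21181 `NNDivisionHard`. -/
theorem nnDivisionHard_of_flat_order
    (hA : ∀ r n : ℕ, 1 ≤ r → (r + 1) * (2 * r + 1) ≤ n →
      ∃ (Z : Finset (Fin (2 * n) × Fin (2 * n)))
        (f : (QGV r × QGV r) × Bool × Bool → Fin (2 * n) × Fin (2 * n)),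
        (fun x : (Fin (2 * n) × Fin (2 * n)) → ℝ => x ∘ f) ''
            (suppPts (nestFreeMatchingPoly n ℝ≥0) ∩ {x | ∀ e ∈ Z, x e = 0}) = Set.range (patternVec r))
    (hF : GridCorCliqueFace)
    (hD : ∃ k : ℕ, ∀ (n : ℕ) (h : MvPolynomial (Fin (2 * n) × Fin (2 * n)) ℝ≥0), h ≠ 0 →
      ∃ (h' : MvPolynomial (Fin (2 * n) × Fin (2 * n)) ℝ≥0) (d : ℕ), homogeneousComponent d h' ≠ 0 ∧
        d ≤ 2 ^ ((Nat.log 2 n + Nat.log 2 (complexity (nestFreeMatchingPoly n ℝ≥0 * h)) + k) ^ k) ∧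
          complexity (nestFreeMatchingPoly n ℝ≥0 * h') ≤
            2 ^ ((Nat.log 2 n + Nat.log 2 (complexity (nestFreeMatchingPoly n ℝ≥0 * h)) + k) ^ k)) :
    NNDivisionHard :=
  NNOrderRung.nnDivisionHard_of_rung_of_orderReduction (rung_of_flat hA hF) hD

/-- **THE RESIDUAL PICTURE BY NAME (degree form)**: A1 + G♭ (stmt-27045) + the DEGREE reduction N2 (unfolded) ⇒ the
route's residual item stmt-21181 `NNDivisionHard`. -/
theorem nnDivisionHard_of_flat
    (hA : ∀ r n : ℕ, 1 ≤ r → (r + 1) * (2 * r + 1) ≤ n →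
      ∃ (Z : Finset (Fin (2 * n) × Fin (2 * n)))
        (f : (QGV r × QGV r) × Bool × Bool → Fin (2 * n) × Fin (2 * n)),
        (fun x : (Fin (2 * n) × Fin (2 * n)) → ℝ => x ∘ f) ''
            (suppPts (nestFreeMatchingPoly n ℝ≥0) ∩ {x | ∀ e ∈ Z, x e = 0}) = Set.range (patternVec r))
    (hF : GridCorCliqueFace)
    (hD : ∃ k : ℕ, ∀ (n : ℕ) (h : MvPolynomial (Fin (2 * n) × Fin (2 * n)) ℝ≥0), h ≠ 0 →
      ∃ h' : MvPolynomial (Fin (2 * n) × Fin (2 * n)) ℝ≥0, h' ≠ 0 ∧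
        h'.totalDegree ≤
            2 ^ ((Nat.log 2 n + Nat.log 2 (complexity (nestFreeMatchingPoly n ℝ≥0 * h)) + k) ^ k) ∧
          complexity (nestFreeMatchingPoly n ℝ≥0 * h') ≤
            2 ^ ((Nat.log 2 n + Nat.log 2 (complexity (nestFreeMatchingPoly n ℝ≥0 * h)) + k) ^ k)) :
    NNDivisionHard :=
  NNOrderRung.nnDivisionHard_of_rung_of_reduction (rung_of_flat hA hF) hD

/-- ★ **THE RESIDUAL PICTURE BY NAME, A1 discharged**: G♭ (stmt-27045) + the ORDER reduction N2♯ (unfolded) ⇒ the route's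
residual item stmt-21181 `NNDivisionHard` — after this line, 21181 is EXACTLY as open as N2♯. -/
theorem nnDivisionHard_of_27045_order (hF : GridCorCliqueFace)
    (hD : ∃ k : ℕ, ∀ (n : ℕ) (h : MvPolynomial (Fin (2 * n) × Fin (2 * n)) ℝ≥0), h ≠ 0 →
      ∃ (h' : MvPolynomial (Fin (2 * n) × Fin (2 * n)) ℝ≥0) (d : ℕ), homogeneousComponent d h' ≠ 0 ∧
        d ≤ 2 ^ ((Nat.log 2 n + Nat.log 2 (complexity (nestFreeMatchingPoly n ℝ≥0 * h)) + k) ^ k) ∧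
          complexity (nestFreeMatchingPoly n ℝ≥0 * h') ≤
            2 ^ ((Nat.log 2 n + Nat.log 2 (complexity (nestFreeMatchingPoly n ℝ≥0 * h)) + k) ^ k)) :
    NNDivisionHard :=
  NNOrderRung.nnDivisionHard_of_rung_of_orderReduction (rung_of_27045 hF) hD

end GridCorShadow

end Summit.ValiantsHypothesis.ValiantsHypothesis.Theorems.FifoMatching

end
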